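import Summits.Langlands.Langlands.Theorems.PicardMuOrdinaryMuOrdinaryFamilyRTThorneArithmeticPoints
import Literature.NumberTheory.GaloisRepresentations.SorensenPatchingHypotheses
import HarnessLib

/-!
# Crux `MuOrdinaryFamilyRT` (stmt-Langlands-13757), line `thorne-minimal-lift`: glue G1 of
# `stub_pointAutomorphicT` — transport of the trace polarization from `Γ_{F'}` to `Γ_L` along the
# outer-conjugation bridge (`tracePolarizedHom_restrict_outerConj`, PROVED)

`TracePolarizedHom F' m ρ` (…ThorneCompanionsDebts § 1) records the polarization of a homomorphism
`ρ : Γ_{F'} → GL₃(ℚ̄₃)` in trace form, `tr ρ(θ_c σ) = ε(σ)^m · tr ρ(σ⁻¹)`, along the outer action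
`θ_c = absGaloisOuterConj ℚ F' c` of EVERY complex conjugation `c ∈ Γ_ℚ` (`F'/ℚ` Galois).  Thorne's
theorem (`Thorne2017.automorphyLifting_unitary_ordinaryMinimal`) consumes the same identity for the
restriction `ρ ∘ res_{L → F'}` to a CM extension `L ⊇ F'` (NOT assumed Galois over `ℚ`), along the outer
action `absGaloisOuterConj L⁺ L c` of a lift `c ∈ Γ_{L⁺}` of the complex conjugation of `L`
(`absGaloisQuot L⁺ L c = complexConj L`, `L⁺ = NumberField.maximalRealSubfield L`).  This file proves the
transport, registered stub `tracePolarizedHom_restrict_outerConj` of the line: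

* § 1 complex conjugations: the restriction to `Γ_ℚ` of a complex conjugation of `Γ_M` is a complex
  conjugation (`isComplexConjugation_absGaloisRestrict_rat`), and a complex conjugation of `Γ_{L⁺}` induces
  `complexConj L` on the CM field `L` (`absGaloisQuot_eq_complexConj`: embeddings of a CM field intertwine
  the complex conjugations, Mathlib `NumberField.IsCMField.complexEmbedding_complexConj`);
* § 2 the bridge `exists_absGaloisRestrict_outerConj_eq_outerConj_rat`: for the towers `ℚ ⊆ F' ⊆ L` and
  `ℚ ⊆ E ⊆ L` (`F'/ℚ` and `L/E` Galois) there is a FIXED `γ ∈ Γ_ℚ` with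
  `res_{F'}^L (θ^{E,L}_c x) = θ^{ℚ,F'}_{γ · res_ℚ^E c · γ⁻¹} (res_{F'}^L x)` for all `c ∈ Γ_E`, `x ∈ Γ_L`
  (restriction maps along towers agree up to a fixed inner automorphism,
  `SorensenPatching.exists_absGaloisRestrict_absGaloisRestrict_eq_conj`; `res` is injective);
* § 3 the stub: replace the given lift `c` by a genuine complex conjugation `c' ∈ Γ_{L⁺}` (both induce
  `complexConj L`, so `c = c' · res h` with `h ∈ Γ_L` and `θ_c = θ_{c'} ∘ Int(h)`), push through the
  bridge (`γ · res c' · γ⁻¹` is a complex conjugation of `Γ_ℚ`, `isComplexConjugation_conj`), apply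
  `TracePolarizedHom` at `res (h σ h⁻¹)`, and finish with `ε_{F'} ∘ res = ε_L`
  (`cyclotomicCharacter_absGaloisRestrict`) and conjugation invariance of `ε` and of the trace.
-/

set_option linter.dupNamespace false -- `Summit.Langlands.Langlands.…` is the problem's namespace

namespace Summit.Langlands.Langlands.Cruxes.MuOrdinaryFamilyRT.ThorneMinimalLift

open scoped NumberField Polynomial Matrix Classical
open Field IsDedekindDomain Polynomial
open Literature.NumberTheory.GaloisRepresentations Literature.NumberTheory.Automorphic
open Summit.Langlands.Langlands.Cruxes.MuOrdinaryFamilyRT.CharZeroDominance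

noncomputable section

/-! ## 1. Complex conjugations: restriction to `Γ_ℚ`; the automorphism induced on a CM field -/

/-- **Restriction of a complex conjugation to `Γ_ℚ` is a complex conjugation**: if `c ∈ Γ_M` acts as
complex conjugation under an embedding `ι : M̄ → ℂ` over a real embedding `φ` of `M`, then `res_ℚ^M c`
acts as complex conjugation under `ι ∘ (ℚ̄ → M̄)` (`absGaloisRestrict_apply_smul`), an embedding over
THE embedding `ℚ → ℝ` (`ℚ →+* ℂ` is a subsingleton). -/
-- adapted from Summit.Langlands.Langlands.Theorems.HostInducedRep.OneTransparentPane.isComplexConjugation_absGaloisRestrict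
-- (Summits/…/QuadraticWindowHostInducedRepMemberParity, not imported here)
theorem isComplexConjugation_absGaloisRestrict_rat {M : Type*} [Field M] [CharZero M] {φ : M →+* ℝ}
    {c : absoluteGaloisGroup M} (hc : IsComplexConjugation φ c) :
    IsComplexConjugation (algebraMap ℚ ℝ) (absGaloisRestrict ℚ M c) := by
  obtain ⟨i, -, hic⟩ := isComplexConjugation_iff.mp hc
  refine isComplexConjugation_iff.mpr
    ⟨i.comp (absClosureEmbedding ℚ M : AlgebraicClosure ℚ →+* AlgebraicClosure M),
      Subsingleton.elim _ _, fun x ↦ ?_⟩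
  simp only [RingHom.comp_apply, RingHom.coe_coe]
  rw [absGaloisRestrict_apply_smul]
  exact hic _

/-- **A complex conjugation of `Γ_{L⁺}` induces `complexConj L` on the CM field `L`.**  If `c ∈ Γ_{L⁺}`
acts as complex conjugation under an embedding `ι : \overline{L⁺} → ℂ`, then on the copy `e(L)` of `L`
(`absEmbedding L⁺ L`) it acts as `conj` under `ι`, i.e. `absGaloisQuot L⁺ L c` is the conjugation of the
complex embedding `ι ∘ e` of `L`, which is `complexConj L`
(Mathlib `NumberField.IsCMField.complexEmbedding_complexConj`). -/
theorem absGaloisQuot_eq_complexConj {L : Type*} [Field L] [NumberField L] [NumberField.IsCMField L]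
    {φ : NumberField.maximalRealSubfield L →+* ℝ}
    {c : absoluteGaloisGroup (NumberField.maximalRealSubfield L)} (hc : IsComplexConjugation φ c) :
    absGaloisQuot (NumberField.maximalRealSubfield L) L c = NumberField.IsCMField.complexConj L := by
  obtain ⟨i, -, hic⟩ := isComplexConjugation_iff.mp hc
  ext z
  let ψ : L →+* ℂ := i.comp (absEmbedding (NumberField.maximalRealSubfield L) L).toRingHom
  apply ψ.injective
  rw [NumberField.IsCMField.complexEmbedding_complexConj]
  change i (absEmbedding _ L (absGaloisQuot _ L c z)) = starRingEnd ℂ (i (absEmbedding _ L z))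
  rw [absEmbedding_absGaloisQuot_apply, hic]

/-! ## 2. The outer-conjugation bridge between the towers `ℚ ⊆ F' ⊆ L` and `ℚ ⊆ E ⊆ L` -/

/-- **Restriction `Γ_L → Γ_{F'}` intertwines the outer action of `Γ_E` on `Γ_L` with the outer action of
`Γ_ℚ` on `Γ_{F'}`**, up to moving the acting element by a FIXED inner automorphism of `Γ_ℚ`: for towers
`ℚ ⊆ F' ⊆ L` and `ℚ ⊆ E ⊆ L` with `F'/ℚ` and `L/E` Galois there is `γ ∈ Γ_ℚ` with
`res_{F'}^L (θ^{E,L}_c x) = θ^{ℚ,F'}_{γ · res_ℚ^E c · γ⁻¹} (res_{F'}^L x)` for all `c ∈ Γ_E`, `x ∈ Γ_L`.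
Proof: both composites `Γ_L → Γ_{F'} → Γ_ℚ` and `Γ_L → Γ_E → Γ_ℚ` are `res_ℚ^L` up to fixed conjugations
`γ₁`, `γ₂` (`SorensenPatching.exists_absGaloisRestrict_absGaloisRestrict_eq_conj`); take `γ = γ₁ γ₂⁻¹` and
compare images in `Γ_ℚ` (`res_ℚ^{F'}` is injective, `res (θ_τ σ) = τ res(σ) τ⁻¹`). -/
theorem exists_absGaloisRestrict_outerConj_eq_outerConj_rat (F' E L : Type*) [Field F'] [NumberField F']
    [IsGalois ℚ F'] [Field E] [CharZero E] [Field L] [NumberField L] [Algebra F' L] [Algebra E L]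
    [IsGalois E L] :
    ∃ γ : absoluteGaloisGroup ℚ, ∀ (c : absoluteGaloisGroup E) (x : absoluteGaloisGroup L),
      absGaloisRestrict F' L (absGaloisOuterConj E L c x) =
        absGaloisOuterConj ℚ F' (γ * absGaloisRestrict ℚ E c * γ⁻¹) (absGaloisRestrict F' L x) := by
  obtain ⟨γ₁, hγ₁⟩ := SorensenPatching.exists_absGaloisRestrict_absGaloisRestrict_eq_conj ℚ F' L
  obtain ⟨γ₂, hγ₂⟩ := SorensenPatching.exists_absGaloisRestrict_absGaloisRestrict_eq_conj ℚ E L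
  have e1 : ∀ y : absoluteGaloisGroup L, absGaloisRestrict ℚ L y =
      γ₂⁻¹ * absGaloisRestrict ℚ E (absGaloisRestrict E L y) * γ₂ := fun y ↦ by
    rw [hγ₂]; group
  refine ⟨γ₁ * γ₂⁻¹, fun c x ↦ absGaloisRestrict_injective ℚ F' ?_⟩
  rw [hγ₁, absGaloisRestrict_absGaloisOuterConj, hγ₁, e1 (absGaloisOuterConj E L c x), e1 x,
    absGaloisRestrict_absGaloisOuterConj]
  simp only [map_mul, map_inv]
  group

/-! ## 3. The stub: polarization transport `F' ↝ L` -/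

/-- **Glue G1 of `stub_pointAutomorphicT` (registered stub `tracePolarizedHom_restrict_outerConj`): the trace
polarization of `ρ : Γ_{F'} → GL₃(ℚ̄₃)` along the complex conjugations of `Γ_ℚ` (`TracePolarizedHom F' m ρ`,
`F'/ℚ` Galois CM) transports to the restriction `ρ ∘ res_{F'}^L` to any CM number field `L ⊇ F'` along the
outer action `absGaloisOuterConj L⁺ L c` of ANY lift `c ∈ Γ_{L⁺}` of the complex conjugation of `L`:
`tr ρ(res(θ_c σ)) = ε_L(σ)^m · tr ρ(res σ⁻¹)`.**  Proof: a genuine complex conjugation `c' ∈ Γ_{L⁺}` (at a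
real place of the totally real `L⁺`, `exists_isComplexConjugation`) also induces `complexConj L`
(`absGaloisQuot_eq_complexConj`), so `c = c' · res h` with `h ∈ Γ_L` (`absGaloisQuot_eq_one_iff`) and
`θ_c σ = θ_{c'}(h σ h⁻¹)`; by the bridge (`exists_absGaloisRestrict_outerConj_eq_outerConj_rat`)
`res(θ_{c'} y) = θ^{ℚ,F'}_{c₁}(res y)` with `c₁ = γ · res_ℚ^{L⁺} c' · γ⁻¹` a complex conjugation of `Γ_ℚ`
(`isComplexConjugation_absGaloisRestrict_rat`, `isComplexConjugation_conj`); apply `TracePolarizedHom` at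
`res(h σ h⁻¹)` and finish with `ε_{F'}(res y) = ε_L(y)` (`cyclotomicCharacter_absGaloisRestrict`),
`ε_L(h σ h⁻¹) = ε_L(σ)` and `tr ρ(res(h σ⁻¹ h⁻¹)) = tr ρ(res σ⁻¹)` (`Matrix.trace_units_conj`). -/
theorem tracePolarizedHom_restrict_outerConj : ∀ (F' : Type) [Field F'] [NumberField F'] [IsGalois ℚ F'] [NumberField.IsCMField F'] (L : Type) [Field L] [NumberField L] [NumberField.IsCMField L] [Algebra F' L] (m : ℤ) (ρ : absoluteGaloisGroup F' →* GL (Fin 3) (PadicAlgCl 3)), TracePolarizedHom F' m ρ → ∀ c : absoluteGaloisGroup (NumberField.maximalRealSubfield L), absGaloisQuot (NumberField.maximalRealSubfield L) L c = NumberField.IsCMField.complexConj L → ∀ σ : absoluteGaloisGroup L, (ρ (absGaloisRestrict F' L (absGaloisOuterConj (NumberField.maximalRealSubfield L) L c σ))).val.trace = algebraMap ℤ_[3] (PadicAlgCl 3) (((GaloisRep.cyclotomicCharacter L 3 σ) ^ m : ℤ_[3]ˣ) : ℤ_[3]) * (ρ (absGaloisRestrict F' L σ⁻¹)).val.trace :=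 by
  intro F' _ _ _ _ L _ _ _ _ m ρ hρ c hc σ
  -- (A) a genuine complex conjugation `c' ∈ Γ_{L⁺}` induces `complexConj L` too, so `c = c' · res h`
  obtain ⟨w⟩ : Nonempty (NumberField.InfinitePlace (NumberField.maximalRealSubfield L)) := inferInstance
  obtain ⟨c', hc'⟩ := exists_isComplexConjugation
    (NumberField.InfinitePlace.embedding_of_isReal (NumberField.IsTotallyReal.isReal w))
  obtain ⟨h, hh⟩ : c'⁻¹ * c ∈ (absGaloisRestrict (NumberField.maximalRealSubfield L) L).range := by
    rw [← absGaloisQuot_eq_one_iff, map_mul, map_inv, absGaloisQuot_eq_complexConj hc', hc,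
      inv_mul_cancel]
  change absGaloisRestrict _ L h = c'⁻¹ * c at hh
  have hcc : c = c' * absGaloisRestrict (NumberField.maximalRealSubfield L) L h := by
    rw [hh, mul_inv_cancel_left]
  -- (B) the bridge, and `γ · res c' · γ⁻¹` is a complex conjugation of `Γ_ℚ`
  obtain ⟨γ, hγ⟩ :=
    exists_absGaloisRestrict_outerConj_eq_outerConj_rat F' (NumberField.maximalRealSubfield L) L
  have hc₁ : IsComplexConjugation (algebraMap ℚ ℝ)
      (γ * absGaloisRestrict ℚ (NumberField.maximalRealSubfield L) c' * γ⁻¹) :=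
    isComplexConjugation_conj (isComplexConjugation_absGaloisRestrict_rat hc') γ
  -- (C) assembly
  have hpol := hρ _ hc₁ (absGaloisRestrict F' L (h * σ * h⁻¹))
  have hε : GaloisRep.cyclotomicCharacter L 3 (h * σ * h⁻¹) = GaloisRep.cyclotomicCharacter L 3 σ := by
    rw [map_mul, map_mul, map_inv, mul_inv_cancel_comm]
  have hinv : (absGaloisRestrict F' L (h * σ * h⁻¹))⁻¹ =
      absGaloisRestrict F' L h * absGaloisRestrict F' L σ⁻¹ * (absGaloisRestrict F' L h)⁻¹ := by
    simp only [map_mul, map_inv]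
    group
  have htr : (ρ (absGaloisRestrict F' L (h * σ * h⁻¹))⁻¹).val.trace =
      (ρ (absGaloisRestrict F' L σ⁻¹)).val.trace := by
    rw [hinv, map_mul, map_mul, map_inv ρ, Units.val_mul, Units.val_mul, Matrix.trace_units_conj]
  rw [hcc, absGaloisOuterConj_mul_apply, absGaloisOuterConj_absGaloisRestrict_apply, hγ, hpol,
    cyclotomicCharacter_absGaloisRestrict, hε, htr]

end

end Summit.Langlands.Langlands.Cruxes.MuOrdinaryFamilyRT.ThorneMinimalLift
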